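import Literature.IUT.HodgeTheaters.Cor53iArithDivThroughAutOfCor411
import Literature.IUT.HodgeTheaters.Cor53TelescopeCensusKnit
import Literature.AlgebraicGeometry.Frobenioids.ArithDivisorMonoidRigidOfPrincipal
import HarnessLib

/-!
# [IUTchI] Cor 5.3 (i) at the GENUINE `ℱ^⊛(†𝒟^⊚)`: `hker⊛` from the CLASSICAL rigidity of the arithmetic divisor monoid
# and print's Ex 5.1 (v) «identity on the rational-function monoid» — the law `hrat⊛` REDUCED (R81 file 2 of 2)

S. Mochizuki, *Inter-universal Teichmüller theory I*, kurims manuscript (May 2020), §5 Corollary 5.3 (i) p. 144 l. 2–11,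
proof p. 144 l. 24–33 («follows immediately from the category-theoreticity of the "isomorphism `𝕄^⊛(†𝒟^⊚) ⥲ †𝕄^⊛`"
of Example 5.1, (v)»); Example 5.1 (v) pp. 127–128 ([IUTchI] Cor 5.3 (i) p.144; Ex 5.1 (v) p.128)
[claim: Mochizuki2012, status: disputed] (D-0012 claim key; nothing of the series is asserted; no side taken on [IUTchIII]
Cor. 3.12).  [FrdI]: S. Mochizuki, *The geometry of Frobenioids I*, Kyushu J. Math. **62** (2008), Thm 5.2 (i) p. 100,
Cor 4.11 (iv) p. 92, Prop 5.6 p. 105 [cite: MochizukiFrdI2008, Thm. 5.2(i) p.100].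

PROOF-ONLY (theorems only; cell abc-iut, seat abc-iut-L5-t11 gen 16, row R81 «COR53I-HRAT@ARITH», abc-iut-L5-lead
RULINGS #148 (2) / #149 (4)).  STATE OF RECORD: abc-iut-L5-t4 g7's ★ p517769 `Cor53.arith_rigidOverBase_of_divRatioRigid`
gives `RigidOverBase (arith F).modelBase` (= `hker⊛`) from the ONE law `hrat⊛ = ∃ η, (hdiv) ∧ (hratio)`.  File 1
(`Cor53iArithDivThroughAutOfCor411`, this seat) PROVED from abc-iut-w4-d109's hypothesis-free [FrdI] Cor 4.11 (iv)
(`exists_cor411iv_data_arith`) that every `Ψ` over the identity of `†𝒟^⊛` moves zero divisors through a natural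
automorphism `θ_Ψ` of `Φ^⊛` over `𝟭` and a unique `η'` — so (hdiv) ⟺ `θ_Ψ = 1`, which is NOT an [FrdI] statement and
is false for a bare natural automorphism of `Φ^⊛` (archimedean rescaling).  THIS FILE:

* § A `Cor53.arith_divAut_fixes_divB_of_ratio` (PROVED bookkeeping in the [FrdI] Thm 5.2 (i) category): if `Ψ` moves zero
  divisors through `(θ, η')` and preserves through `η'` the birational units of parallel linear arrows (hratio), then at
  every `A ∈ Ob(†𝒟^⊛)` the Grothendieck-group extension of `θ_A` FIXES EVERY PRINCIPAL DIVISOR `Div_B(w)`, `w ∈ 𝔹(A)`.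
  (Two parallel linear arrows `(1, 𝟙, a, w)`, `(1, 𝟙, b, 1)` out of `(A, 0)` with `of a = Div_B(w) · of b`; Ψ's relations
  (d); `Div_B` natural; pull-back along the iso `η'_X` injective.)
* § B the one-calls **`Cor53.arith_rigidOverBase_of_divMonoidRigid_of_ratioRigid (hΦ) (hB)`**,
  `…_descend_injective_…`, `…_descendBijective_…_of_lifts`: `hker⊛` (resp. injectivity of `Aut(ℱ^⊛) → Aut(†𝒟^⊛)`,
  resp. Cor 5.3 (i) AS PRINTED with `hlift⊛`) from TWO named binders replacing `hrat⊛`: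
  - `hΦ` — **Φ-RIGID-PRINC** (CLASSICAL number theory, per object, no naturality: «a monoid automorphism of the effective
    arithmetic divisors `EffArithDivisor(K_A)` of the number field of `A` whose extension to `Φ^gp` fixes every principal
    divisor is the identity»; finite part: distinct primes are separated by principal divisors; archimedean part: the
    monomial rescaling is pinned by `log ‖u‖_w` — Dirichlet / weak approximation).  Interim label G-L5t11g16-1; row R82
    «PHI-RIGID-PRINC@ARITH-DIVISOR» (abc-iut-L5-lead RULINGS #149 (5)) PROVES it in exactly this shape — not a FACT row.
  - `hB` — **𝔹-RATIO** = the (hratio) conjunct of `hrat⊛` verbatim with its `∃ η`: «`Ψ` over the identity induces, through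
    some base identification, the identity on the rational-function monoid» — print's Ex 5.1 (v) input (category-theoreticity
    of `𝕄^⊛(†𝒟^⊚) ⥲ †𝕄^⊛`; FACT-SHAPE, F-row pending with abc-iut-F-lit); by file 1's `arith_overBase_iso_unique` the
    `η` it provides IS the `η'` of the Cor 4.11 data.
  CENSUS of the `⊛`-slot after this file (abc-iut-L5-lead #149 (4) target): `hker⊛ ⟸` LAW 0 · [FrdI] Cor 4.11 (iv) PROVED
  · Φ-RIGID-PRINC (classical, R82) · FACT-SHAPE {𝔹-RATIO = Ex 5.1 (v)}; (+ `hlift⊛` for the bijective form).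

HONEST TAGS.  NOT claimed: Φ-RIGID-PRINC (classical, displayed), 𝔹-RATIO (Ex 5.1 (v), displayed), `hlift⊛`; no token moves
on this file alone; typed ≠ proved; nothing here asserts abc proved or refuted.
-/

noncomputable section

set_option backward.isDefEq.respectTransparency false

namespace Literature.AlgebraicGeometry.Frobenioids

open CategoryTheory Opposite

universe w v u

variable {D : Type u} [Category.{v} D]

/-- `of (f^* a) = f^* (of a)` in `Φ^gp`: the transport on `Φ^gp` extends the pull-back on `Φ` ([FrdI] Thm 5.2 (i),
`pullGp_of` read backwards through `pull Φ f = Φ(f)`). [cite: MochizukiFrdI2008, Thm. 5.2(i) p.100] -/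
theorem of_pull_eq_pullGp_of (Φ : Dᵒᵖ ⥤ CommMonCat.{w}) {X Y : D} (f : X ⟶ Y) (a : Φ.obj (op Y)) :
    Algebra.GrothendieckGroup.of (pull Φ f a) = pullGp Φ f (Algebra.GrothendieckGroup.of a) :=
  (pullGp_of f a).symm

/-- Pull-back on `Φ^gp` along an ISOMORPHISM of the base is injective (its inverse is the pull-back along the inverse).
[cite: MochizukiFrdI2008, Thm. 5.2(i) p.100] -/
theorem pullGp_injective_of_iso (Φ : Dᵒᵖ ⥤ CommMonCat.{w}) {X Y : D} (e : X ≅ Y) :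
    Function.Injective (pullGp Φ e.hom) := by
  intro u v h
  have h' := congrArg (pullGp Φ e.inv) h
  rwa [← pullGp_comp, ← pullGp_comp, e.inv_hom_id, pullGp_id, pullGp_id] at h'

end Literature.AlgebraicGeometry.Frobenioids

namespace Literature.IUT.HodgeTheaters

open CategoryTheory Opposite Literature.AlgebraicGeometry.Frobenioids

namespace Cor53

section Arith

variable (F : Type) [Field F] [NumberField F]

/-! ### § A. (hratio) makes the divisor automorphism `θ_Ψ` fix every principal divisor -/

-- The complete proof term (four `let`-bound model-Frobenioid objects/arrows with their relation proofs) needs ≈ 2× the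
-- default budget in the post-elaboration check; every individual step elaborates within the default (checked).
set_option maxHeartbeats 400000 in
/-- **(hratio) ⇒ `θ_Ψ` fixes principal divisors** ([FrdI] Thm 5.2 (i) bookkeeping at `ℱ^⊛(†𝒟^⊚)`).  Let `Ψ` be a
self-equivalence with `Div(Ψ φ) = η'_X^* θ_{Base X}(Div φ)` for all `φ` (file 1's `(θ, η')`) which preserves through `η'`
the birational units of parallel linear arrows.  Then `θ_A^gp(Div_B w) = Div_B w` for every `A` and every `w ∈ 𝔹(A)`:
write `Div_B w · of b = of a` in `Φ^⊛(A)^gp`; the arrows `f = (1, 𝟙, a, w)` and `g = (1, 𝟙, b, 1)` from `(A, 0)` to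
`(A, of b)` are parallel and linear; relations (d) for `Ψ f`, `Ψ g` (same base arrow by naturality of `η'`, `deg_Fr = 1`
by [FrdI] Cor 4.11 (iii)) give `of Div(Ψ f) · Div_B u_{Ψ g} = of Div(Ψ g) · Div_B u_{Ψ f}`; (hratio) gives
`u_{Ψ f} = u_{Ψ g} · η'^* w`; naturality of `Div_B` and injectivity of `η'_X^*` conclude.
([IUTchI] Cor 5.3 (i) p.144) [cite: MochizukiFrdI2008, Thm. 5.2(i) p.100] [claim: Mochizuki2012, status: disputed] -/
theorem arith_divAut_fixes_divB_of_ratio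
    (Ψ : (GlobalDivisorData.arith F).ModelGlobalFrobenioid ≌ (GlobalDivisorData.arith F).ModelGlobalFrobenioid)
    (θ : (ModelFrobenioid.data (GlobalDivisorData.arith F).Φ (GlobalDivisorData.arith F).B (GlobalDivisorData.arith F).div).DivisorMonoidIsoOverBase
        (ModelFrobenioid.data (GlobalDivisorData.arith F).Φ (GlobalDivisorData.arith F).B (GlobalDivisorData.arith F).div)
        (𝟭 (BaseCat (absGalGrp F))))
    (η' : Ψ.functor ⋙ (GlobalDivisorData.arith F).modelBase ≅ (GlobalDivisorData.arith F).modelBase)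
    (hdivθ : ∀ ⦃X Y : (GlobalDivisorData.arith F).ModelGlobalFrobenioid⦄ (φ : X ⟶ Y),
      ModelFrobenioid.div (Ψ.functor.map φ) =
        pull (GlobalDivisorData.arith F).Φ (A := X.base) (B := (Ψ.functor.obj X).base) (η'.hom.app X)
          (θ.iso X.base (ModelFrobenioid.div φ)))
    (hratio : ∀ ⦃X Y : (GlobalDivisorData.arith F).ModelGlobalFrobenioid⦄ (f g : X ⟶ Y), ModelFrobenioid.degFr f = 1 →
      ModelFrobenioid.degFr g = 1 → ModelFrobenioid.baseMap f = ModelFrobenioid.baseMap g →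
        ModelFrobenioid.unit (Ψ.functor.map f) *
            pull (GlobalDivisorData.arith F).B (A := X.base) (B := (Ψ.functor.obj X).base) (η'.hom.app X)
              (ModelFrobenioid.unit g) =
          ModelFrobenioid.unit (Ψ.functor.map g) *
            pull (GlobalDivisorData.arith F).B (A := X.base) (B := (Ψ.functor.obj X).base) (η'.hom.app X)
              (ModelFrobenioid.unit f)) :
    ∀ (A : BaseCat (absGalGrp F)) (w : (GlobalDivisorData.arith F).B.obj (op A)),
      MonGp.map (MulEquiv.toMonoidHom (M := (GlobalDivisorData.arith F).Φ.obj (op A))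
          (N := (GlobalDivisorData.arith F).Φ.obj (op A)) (θ.iso A))
          (divB (GlobalDivisorData.arith F).Φ (GlobalDivisorData.arith F).B (GlobalDivisorData.arith F).div (op A) w) =
        divB (GlobalDivisorData.arith F).Φ (GlobalDivisorData.arith F).B (GlobalDivisorData.arith F).div (op A) w := by
  intro A w
  -- `Div_B w · of b = of a` in `Φ^⊛(A)^gp`
  obtain ⟨⟨a, ⟨b, hb⟩⟩, hab⟩ :=
    (Localization.monoidOf (⊤ : Submonoid ((GlobalDivisorData.arith F).Φ.obj (op A)))).surj
      (divB (GlobalDivisorData.arith F).Φ (GlobalDivisorData.arith F).B (GlobalDivisorData.arith F).div (op A) w)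
  have hab' : divB (GlobalDivisorData.arith F).Φ (GlobalDivisorData.arith F).B (GlobalDivisorData.arith F).div (op A) w *
      Algebra.GrothendieckGroup.of b = Algebra.GrothendieckGroup.of a := hab
  -- the two parallel linear arrows `f = (1, 𝟙, a, w)`, `g = (1, 𝟙, b, 1)` from `(A, 0)` to `(A, of b)`
  let X : (GlobalDivisorData.arith F).ModelGlobalFrobenioid := ⟨A, 1⟩
  let Y : (GlobalDivisorData.arith F).ModelGlobalFrobenioid := ⟨A, Algebra.GrothendieckGroup.of b⟩
  let g : X ⟶ Y :=
    { degFr := 1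
      base := 𝟙 A
      div := b
      unit := 1
      rel := by
        show (1 : Algebra.GrothendieckGroup ((GlobalDivisorData.arith F).Φ.obj (op A))) ^ ((1 : ℕ+) : ℕ) *
            Algebra.GrothendieckGroup.of b =
          pullGp (GlobalDivisorData.arith F).Φ (𝟙 A) (Algebra.GrothendieckGroup.of b) *
            divB (GlobalDivisorData.arith F).Φ (GlobalDivisorData.arith F).B (GlobalDivisorData.arith F).div (op A) 1
        rw [PNat.one_coe, pow_one, one_mul, pullGp_id, map_one, mul_one] }
  let f : X ⟶ Y :=
    { degFr := 1
      base := 𝟙 A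
      div := a
      unit := w
      rel := by
        show (1 : Algebra.GrothendieckGroup ((GlobalDivisorData.arith F).Φ.obj (op A))) ^ ((1 : ℕ+) : ℕ) *
            Algebra.GrothendieckGroup.of a =
          pullGp (GlobalDivisorData.arith F).Φ (𝟙 A) (Algebra.GrothendieckGroup.of b) *
            divB (GlobalDivisorData.arith F).Φ (GlobalDivisorData.arith F).B (GlobalDivisorData.arith F).div (op A) w
        rw [PNat.one_coe, pow_one, one_mul, pullGp_id, mul_comm]
        exact hab'.symm }
  -- Frobenius degrees of `Ψ f`, `Ψ g` ([FrdI] Cor 4.11 (iii), hypothesis-free at the carrier)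
  have hdeg_f : ModelFrobenioid.degFr (Ψ.functor.map f) = 1 := GlobalDivisorData.preservesDegFr_arith F F Ψ f
  have hdeg_g : ModelFrobenioid.degFr (Ψ.functor.map g) = 1 := GlobalDivisorData.preservesDegFr_arith F F Ψ g
  -- `Base(Ψ f) = Base(Ψ g)` by the naturality of `η'` (both lie over `𝟙 A`)
  have hbase : ModelFrobenioid.baseMap (Ψ.functor.map f) = ModelFrobenioid.baseMap (Ψ.functor.map g) := by
    have nf := η'.hom.naturality f
    have ng := η'.hom.naturality g
    have hfg : (Ψ.functor ⋙ (GlobalDivisorData.arith F).modelBase).map f =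
        (Ψ.functor ⋙ (GlobalDivisorData.arith F).modelBase).map g := by
      rw [← cancel_mono (η'.hom.app Y), nf, ng]
      rfl
    exact hfg
  -- relations (d) of `Ψ f`, `Ψ g`
  have ef := ModelFrobenioid.rel (Ψ.functor.map f)
  have eg := ModelFrobenioid.rel (Ψ.functor.map g)
  rw [hdeg_f, PNat.one_coe, pow_one] at ef
  rw [hdeg_g, PNat.one_coe, pow_one, ← hbase] at eg
  have key : Algebra.GrothendieckGroup.of (ModelFrobenioid.div (Ψ.functor.map f)) *
        divB _ _ (GlobalDivisorData.arith F).div _ (ModelFrobenioid.unit (Ψ.functor.map g)) =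
      Algebra.GrothendieckGroup.of (ModelFrobenioid.div (Ψ.functor.map g)) *
        divB _ _ (GlobalDivisorData.arith F).div _ (ModelFrobenioid.unit (Ψ.functor.map f)) := by
    have h2 : (Ψ.functor.obj X).cls * (Algebra.GrothendieckGroup.of (ModelFrobenioid.div (Ψ.functor.map f)) *
          divB _ _ (GlobalDivisorData.arith F).div _ (ModelFrobenioid.unit (Ψ.functor.map g))) =
        (Ψ.functor.obj X).cls * (Algebra.GrothendieckGroup.of (ModelFrobenioid.div (Ψ.functor.map g)) *
          divB _ _ (GlobalDivisorData.arith F).div _ (ModelFrobenioid.unit (Ψ.functor.map f))) := by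
      rw [← mul_assoc, ef, ← mul_assoc, eg, mul_right_comm]
    exact mul_left_cancel h2
  -- (hratio) for `f`, `g`: `u_{Ψ f} = u_{Ψ g} · η'^* w`
  have hr := hratio f g rfl rfl rfl
  have hug : ModelFrobenioid.unit g = 1 := rfl
  have huf : ModelFrobenioid.unit f = w := rfl
  rw [hug, map_one, mul_one, huf] at hr
  -- `Div_B (η'^* w) = η'^* Div_B w` (naturality of `Div_B`)
  have hdivB : divB _ _ (GlobalDivisorData.arith F).div _ (ModelFrobenioid.unit (Ψ.functor.map f)) =
      divB _ _ (GlobalDivisorData.arith F).div _ (ModelFrobenioid.unit (Ψ.functor.map g)) *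
        pullGp (GlobalDivisorData.arith F).Φ (X := (Ψ.functor.obj X).base) (Y := X.base) (η'.hom.app X)
          (divB (GlobalDivisorData.arith F).Φ (GlobalDivisorData.arith F).B (GlobalDivisorData.arith F).div (op A) w) := by
    rw [hr, map_mul, pullGp_divB]
    rfl
  rw [hdivB, ← mul_assoc] at key
  have key2 : Algebra.GrothendieckGroup.of (ModelFrobenioid.div (Ψ.functor.map f)) =
      Algebra.GrothendieckGroup.of (ModelFrobenioid.div (Ψ.functor.map g)) *
        pullGp (GlobalDivisorData.arith F).Φ (X := (Ψ.functor.obj X).base) (Y := X.base) (η'.hom.app X)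
          (divB (GlobalDivisorData.arith F).Φ (GlobalDivisorData.arith F).B (GlobalDivisorData.arith F).div (op A) w) := by
    rw [mul_right_comm] at key
    exact mul_right_cancel key
  -- zero divisors of `Ψ f`, `Ψ g` through `(θ, η')`
  have hdf : ModelFrobenioid.div (Ψ.functor.map f) =
      pull (GlobalDivisorData.arith F).Φ (A := X.base) (B := (Ψ.functor.obj X).base) (η'.hom.app X) (θ.iso A a) :=
    hdivθ f
  have hdg : ModelFrobenioid.div (Ψ.functor.map g) =
      pull (GlobalDivisorData.arith F).Φ (A := X.base) (B := (Ψ.functor.obj X).base) (η'.hom.app X) (θ.iso A b) :=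
    hdivθ g
  rw [hdf, hdg, of_pull_eq_pullGp_of, of_pull_eq_pullGp_of, ← map_mul] at key2
  -- pull-back along the isomorphism `η'_X` is injective
  have key3 : Algebra.GrothendieckGroup.of (M := (GlobalDivisorData.arith F).Φ.obj (op A)) (θ.iso A a) =
      Algebra.GrothendieckGroup.of (M := (GlobalDivisorData.arith F).Φ.obj (op A)) (θ.iso A b) *
        divB (GlobalDivisorData.arith F).Φ (GlobalDivisorData.arith F).B (GlobalDivisorData.arith F).div (op A) w :=
    pullGp_injective_of_iso (GlobalDivisorData.arith F).Φ (η'.app X) key2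
  -- conclude: `θ^gp (Div_B w) = θ^gp (of a / of b) = of (θ a) / of (θ b) = Div_B w`
  have hw : divB (GlobalDivisorData.arith F).Φ (GlobalDivisorData.arith F).B (GlobalDivisorData.arith F).div (op A) w =
      Algebra.GrothendieckGroup.of a * (Algebra.GrothendieckGroup.of b)⁻¹ :=
    eq_mul_inv_of_mul_eq hab'
  have h1 : MonGp.map (MulEquiv.toMonoidHom (M := (GlobalDivisorData.arith F).Φ.obj (op A))
        (N := (GlobalDivisorData.arith F).Φ.obj (op A)) (θ.iso A)) (Algebra.GrothendieckGroup.of a) =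
      Algebra.GrothendieckGroup.of (M := (GlobalDivisorData.arith F).Φ.obj (op A)) (θ.iso A a) :=
    MonGp.map_of _ a
  have h2 : MonGp.map (MulEquiv.toMonoidHom (M := (GlobalDivisorData.arith F).Φ.obj (op A))
        (N := (GlobalDivisorData.arith F).Φ.obj (op A)) (θ.iso A)) (Algebra.GrothendieckGroup.of b) =
      Algebra.GrothendieckGroup.of (M := (GlobalDivisorData.arith F).Φ.obj (op A)) (θ.iso A b) :=
    MonGp.map_of _ b
  have s1 : MonGp.map (MulEquiv.toMonoidHom (M := (GlobalDivisorData.arith F).Φ.obj (op A)) (N := (GlobalDivisorData.arith F).Φ.obj (op A)) (θ.iso A)) (Algebra.GrothendieckGroup.of a) * (MonGp.map (MulEquiv.toMonoidHom (M := (GlobalDivisorData.arith F).Φ.obj (op A)) (N := (GlobalDivisorData.arith F).Φ.obj (op A)) (θ.iso A)) (Algebra.GrothendieckGroup.of b))⁻¹ =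
      Algebra.GrothendieckGroup.of (M := (GlobalDivisorData.arith F).Φ.obj (op A)) (θ.iso A a) * (Algebra.GrothendieckGroup.of (M := (GlobalDivisorData.arith F).Φ.obj (op A)) (θ.iso A b))⁻¹ :=
    congrArg₂ (fun x y => x * y⁻¹) h1 h2
  have s2 : Algebra.GrothendieckGroup.of (M := (GlobalDivisorData.arith F).Φ.obj (op A)) (θ.iso A a) * (Algebra.GrothendieckGroup.of (M := (GlobalDivisorData.arith F).Φ.obj (op A)) (θ.iso A b))⁻¹ =
      Algebra.GrothendieckGroup.of (M := (GlobalDivisorData.arith F).Φ.obj (op A)) (θ.iso A b) * divB (GlobalDivisorData.arith F).Φ (GlobalDivisorData.arith F).B (GlobalDivisorData.arith F).div (op A) w * (Algebra.GrothendieckGroup.of (M := (GlobalDivisorData.arith F).Φ.obj (op A)) (θ.iso A b))⁻¹ :=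
    congrArg (· * (Algebra.GrothendieckGroup.of (M := (GlobalDivisorData.arith F).Φ.obj (op A)) (θ.iso A b))⁻¹) key3
  have s3 : Algebra.GrothendieckGroup.of (M := (GlobalDivisorData.arith F).Φ.obj (op A)) (θ.iso A b) * divB (GlobalDivisorData.arith F).Φ (GlobalDivisorData.arith F).B (GlobalDivisorData.arith F).div (op A) w * (Algebra.GrothendieckGroup.of (M := (GlobalDivisorData.arith F).Φ.obj (op A)) (θ.iso A b))⁻¹ = divB (GlobalDivisorData.arith F).Φ (GlobalDivisorData.arith F).B (GlobalDivisorData.arith F).div (op A) w :=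
    mul_inv_cancel_comm _ _
  rw [hw, map_mul, map_inv]
  exact s1.trans (s2.trans (s3.trans hw))

/-! ### § B. The one-calls: `hker⊛` from Φ-RIGID-PRINC (classical) and 𝔹-RATIO (Ex 5.1 (v)) -/

/-- **[IUTchI] Cor 5.3 (i), injectivity content at `ℱ^⊛(†𝒟^⊚)` — `RigidOverBase (arith F).modelBase` (`hker⊛`)
from TWO named binders** replacing abc-iut-L5-t4's law `hrat⊛` (★ p517769): `hΦ` = Φ-RIGID-PRINC (CLASSICAL, per
object: a monoid automorphism of the effective arithmetic divisors of the number field of `A` whose extension to `Φ^gp`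
fixes every principal divisor is the identity; interim label G-L5t11g16-1, row R82 proves it) and `hB` = 𝔹-RATIO
(print's Ex 5.1 (v): every self-equivalence over the identity of `†𝒟^⊛` preserves, through some base identification,
the birational units of parallel linear arrows — FACT-SHAPE).  PROOF: for `Ψ` over the identity take the Cor 4.11 (iv)
data `(θ, η')` of file 1 (`arith_exists_divAut_of_overBase`); `hB`'s identification IS `η'` (`arith_overBase_iso_unique`);
§ A makes `θ^gp` fix principal divisors, `hΦ` makes `θ = 1`, so (hdiv) holds through `η'`; then ★ p517769
`arith_rigidOverBase_of_divRatioRigid`. ([IUTchI] Cor 5.3 (i) p.144) [claim: Mochizuki2012, status: disputed] -/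
theorem arith_rigidOverBase_of_divMonoidRigid_of_ratioRigid
    (hΦ : ∀ (A : BaseCat (absGalGrp F))
      (θ : (GlobalDivisorData.arith F).Φ.obj (op A) ≃* (GlobalDivisorData.arith F).Φ.obj (op A)),
      (∀ w : (GlobalDivisorData.arith F).B.obj (op A),
        MonGp.map θ.toMonoidHom
            (divB (GlobalDivisorData.arith F).Φ (GlobalDivisorData.arith F).B (GlobalDivisorData.arith F).div (op A) w) =
          divB (GlobalDivisorData.arith F).Φ (GlobalDivisorData.arith F).B (GlobalDivisorData.arith F).div (op A) w) →
      ∀ x, θ x = x)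
    (hB : ∀ Ψ : (GlobalDivisorData.arith F).ModelGlobalFrobenioid ≌ (GlobalDivisorData.arith F).ModelGlobalFrobenioid,
      Nonempty (Ψ.functor ⋙ (GlobalDivisorData.arith F).modelBase ≅ (GlobalDivisorData.arith F).modelBase) →
      ∃ η : Ψ.functor ⋙ (GlobalDivisorData.arith F).modelBase ≅ (GlobalDivisorData.arith F).modelBase,
        ∀ ⦃X Y : (GlobalDivisorData.arith F).ModelGlobalFrobenioid⦄ (f g : X ⟶ Y), ModelFrobenioid.degFr f = 1 →
          ModelFrobenioid.degFr g = 1 → ModelFrobenioid.baseMap f = ModelFrobenioid.baseMap g →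
            ModelFrobenioid.unit (Ψ.functor.map f) *
                pull (GlobalDivisorData.arith F).B (A := X.base) (B := (Ψ.functor.obj X).base) (η.hom.app X)
                  (ModelFrobenioid.unit g) =
              ModelFrobenioid.unit (Ψ.functor.map g) *
                pull (GlobalDivisorData.arith F).B (A := X.base) (B := (Ψ.functor.obj X).base) (η.hom.app X)
                  (ModelFrobenioid.unit f)) :
    CatIsomorphism.RigidOverBase (GlobalDivisorData.arith F).modelBase := by
  refine arith_rigidOverBase_of_divRatioRigid F fun Ψ hΨ => ?_
  obtain ⟨θ, η', hdivθ⟩ := GlobalDivisorData.arith_exists_divAut_of_overBase F Ψ hΨ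
  obtain ⟨η, hratio⟩ := hB Ψ hΨ
  obtain rfl : η = η' := GlobalDivisorData.arith_overBase_iso_unique F Ψ η η'
  have hfix := arith_divAut_fixes_divB_of_ratio F Ψ θ η hdivθ hratio
  have hθ : ∀ (A : BaseCat (absGalGrp F)) (x : (GlobalDivisorData.arith F).Φ.obj (op A)), θ.iso A x = x :=
    fun A => hΦ A (θ.iso A) (hfix A)
  refine ⟨η, fun X Y φ => ?_, hratio⟩
  rw [hdivθ φ, hθ]

/-- **[IUTchI] Cor 5.3 (i), INJECTIVITY of `Aut(ℱ^⊛) → Aut(†𝒟^⊛)` at `ℱ^⊛(†𝒟^⊚)`** (the §0 natural map, binders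
discharged by abc-iut-w4-d109) from Φ-RIGID-PRINC (classical) and 𝔹-RATIO (Ex 5.1 (v)) — through ★ p517769's
`arith_descend_injective_of_kernel_trivial` chain. ([IUTchI] Cor 5.3 (i) p.144) [claim: Mochizuki2012, status: disputed] -/
theorem arith_descend_injective_of_divMonoidRigid_of_ratioRigid
    (hΦ : ∀ (A : BaseCat (absGalGrp F))
      (θ : (GlobalDivisorData.arith F).Φ.obj (op A) ≃* (GlobalDivisorData.arith F).Φ.obj (op A)),
      (∀ w : (GlobalDivisorData.arith F).B.obj (op A),
        MonGp.map θ.toMonoidHom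
            (divB (GlobalDivisorData.arith F).Φ (GlobalDivisorData.arith F).B (GlobalDivisorData.arith F).div (op A) w) =
          divB (GlobalDivisorData.arith F).Φ (GlobalDivisorData.arith F).B (GlobalDivisorData.arith F).div (op A) w) →
      ∀ x, θ x = x)
    (hB : ∀ Ψ : (GlobalDivisorData.arith F).ModelGlobalFrobenioid ≌ (GlobalDivisorData.arith F).ModelGlobalFrobenioid,
      Nonempty (Ψ.functor ⋙ (GlobalDivisorData.arith F).modelBase ≅ (GlobalDivisorData.arith F).modelBase) →
      ∃ η : Ψ.functor ⋙ (GlobalDivisorData.arith F).modelBase ≅ (GlobalDivisorData.arith F).modelBase,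
        ∀ ⦃X Y : (GlobalDivisorData.arith F).ModelGlobalFrobenioid⦄ (f g : X ⟶ Y), ModelFrobenioid.degFr f = 1 →
          ModelFrobenioid.degFr g = 1 → ModelFrobenioid.baseMap f = ModelFrobenioid.baseMap g →
            ModelFrobenioid.unit (Ψ.functor.map f) *
                pull (GlobalDivisorData.arith F).B (A := X.base) (B := (Ψ.functor.obj X).base) (η.hom.app X)
                  (ModelFrobenioid.unit g) =
              ModelFrobenioid.unit (Ψ.functor.map g) *
                pull (GlobalDivisorData.arith F).B (A := X.base) (B := (Ψ.functor.obj X).base) (η.hom.app X)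
                  (ModelFrobenioid.unit f)) :
    Function.Injective (CatIsomorphism.descend (GlobalDivisorData.hasUnder_modelBase_arith F F)
      (GlobalDivisorData.underUnique_modelBase_arith F F)) :=
  arith_descend_injective_of_kernel_trivial F (arith_rigidOverBase_of_divMonoidRigid_of_ratioRigid F hΦ hB)

/-- **[IUTchI] Cor 5.3 (i) AS PRINTED («bijective») at `ℱ^⊛(†𝒟^⊚)`**: `CatIsomorphism.DescendBijective` from
Φ-RIGID-PRINC (classical), 𝔹-RATIO (Ex 5.1 (v)) and the surjectivity half `hlift⊛` (functoriality of
`†𝒟^⊚ ↦ ℱ^⊛(†𝒟^⊚)` in base self-equivalences — FACT-policy, BY NAME, not proved here).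
([IUTchI] Cor 5.3 (i) p.144) [claim: Mochizuki2012, status: disputed] -/
theorem arith_descendBijective_of_divMonoidRigid_of_ratioRigid_of_lifts
    (hΦ : ∀ (A : BaseCat (absGalGrp F))
      (θ : (GlobalDivisorData.arith F).Φ.obj (op A) ≃* (GlobalDivisorData.arith F).Φ.obj (op A)),
      (∀ w : (GlobalDivisorData.arith F).B.obj (op A),
        MonGp.map θ.toMonoidHom
            (divB (GlobalDivisorData.arith F).Φ (GlobalDivisorData.arith F).B (GlobalDivisorData.arith F).div (op A) w) =
          divB (GlobalDivisorData.arith F).Φ (GlobalDivisorData.arith F).B (GlobalDivisorData.arith F).div (op A) w) →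
      ∀ x, θ x = x)
    (hB : ∀ Ψ : (GlobalDivisorData.arith F).ModelGlobalFrobenioid ≌ (GlobalDivisorData.arith F).ModelGlobalFrobenioid,
      Nonempty (Ψ.functor ⋙ (GlobalDivisorData.arith F).modelBase ≅ (GlobalDivisorData.arith F).modelBase) →
      ∃ η : Ψ.functor ⋙ (GlobalDivisorData.arith F).modelBase ≅ (GlobalDivisorData.arith F).modelBase,
        ∀ ⦃X Y : (GlobalDivisorData.arith F).ModelGlobalFrobenioid⦄ (f g : X ⟶ Y), ModelFrobenioid.degFr f = 1 →
          ModelFrobenioid.degFr g = 1 → ModelFrobenioid.baseMap f = ModelFrobenioid.baseMap g →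
            ModelFrobenioid.unit (Ψ.functor.map f) *
                pull (GlobalDivisorData.arith F).B (A := X.base) (B := (Ψ.functor.obj X).base) (η.hom.app X)
                  (ModelFrobenioid.unit g) =
              ModelFrobenioid.unit (Ψ.functor.map g) *
                pull (GlobalDivisorData.arith F).B (A := X.base) (B := (Ψ.functor.obj X).base) (η.hom.app X)
                  (ModelFrobenioid.unit f))
    (hlift : ∀ Θ : BaseCat (absGalGrp F) ≌ BaseCat (absGalGrp F),
      ∃ Ψ : (GlobalDivisorData.arith F).ModelGlobalFrobenioid ≌ (GlobalDivisorData.arith F).ModelGlobalFrobenioid,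
        Nonempty (CatIsomorphism.LiesUnder (GlobalDivisorData.arith F).modelBase (GlobalDivisorData.arith F).modelBase Ψ Θ)) :
    CatIsomorphism.DescendBijective (GlobalDivisorData.arith F).modelBase (GlobalDivisorData.arith F).modelBase
      (GlobalDivisorData.hasUnder_modelBase_arith F F) (GlobalDivisorData.underUnique_modelBase_arith F F) :=
  ⟨arith_descend_injective_of_divMonoidRigid_of_ratioRigid F hΦ hB, CatIsomorphism.descend_surjective_of_lifts _ _ hlift⟩

end Arith

end Cor53

end Literature.IUT.HodgeTheaters
/-! ### § C (v2). Φ-RIGID-PRINC DISCHARGED (abc-iut-L5-t1 gen 13, row R82): `hker⊛` from 𝔹-RATIO = [IUTchI] Ex 5.1 (v) ALONE -/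
namespace Literature.IUT.HodgeTheaters

open CategoryTheory Opposite Literature.AlgebraicGeometry.Frobenioids

/-- **Φ-RIGID-PRINC holds at `ℱ^⊛(†𝒟^⊚)`**: the binder `hΦ` of § B DISCHARGED by abc-iut-L5-t1 gen 13's R82 (classical)
`EffArithDivisor.mulEquiv_apply_eq_self_of_map_principal`, their probe one-liner verbatim. [cite: MochizukiFrdI2008, Ex. 6.3 p.113] -/
theorem GlobalDivisorData.arith_divMonoid_eq_self_of_map_divB (F : Type) [Field F] [NumberField F] :
    ∀ (A : BaseCat (absGalGrp F))
      (θ : (GlobalDivisorData.arith F).Φ.obj (op A) ≃* (GlobalDivisorData.arith F).Φ.obj (op A)),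
      (∀ w : (GlobalDivisorData.arith F).B.obj (op A),
          MonGp.map θ.toMonoidHom (divB (arith F).Φ (arith F).B (arith F).div (op A) w) =
            divB (arith F).Φ (arith F).B (arith F).div (op A) w) →
        ∀ x, θ x = x :=
  fun _A θ hθ x => EffArithDivisor.mulEquiv_apply_eq_self_of_map_principal θ hθ x

/-- **[IUTchI] Cor 5.3 (i): `RigidOverBase (arith F).modelBase` (`hker⊛`) at `ℱ^⊛(†𝒟^⊚)` from the SINGLE displayed binder
𝔹-RATIO** = print's Ex 5.1 (v) input «`Ψ` over the identity induces the identity on the rational-function monoid», i.e.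
the FACT-SHAPE of row F-2577 `UniqueCyclotomeIsoFamily` (the uniqueness = category-theoreticity of `𝕄^⊛(†𝒟^⊚) ⥲ †𝕄^⊛`,
p. 128; single-cyclotome form F-2582 `UniqueCyclotomeIso`) — carried BY SHAPE: the bridge `Ψ ↦` induced automorphism of the
Kummer data is not in the tree.  CENSUS: LAW 0 · [FrdI] Cor 4.11 (iv) PROVED · Φ-RIGID-PRINC PROVED · FACT-SHAPE 1
{F-2577}. ([IUTchI] Cor 5.3 (i) p.144; Ex 5.1 (v) p.128) [claim: Mochizuki2012, status: disputed] -/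
theorem Cor53.arith_rigidOverBase_of_ratioRigid (F : Type) [Field F] [NumberField F]
    (hB : ∀ Ψ : (GlobalDivisorData.arith F).ModelGlobalFrobenioid ≌ (GlobalDivisorData.arith F).ModelGlobalFrobenioid,
      Nonempty (Ψ.functor ⋙ (GlobalDivisorData.arith F).modelBase ≅ (GlobalDivisorData.arith F).modelBase) →
      ∃ η : Ψ.functor ⋙ (GlobalDivisorData.arith F).modelBase ≅ (GlobalDivisorData.arith F).modelBase,
        ∀ ⦃X Y : (GlobalDivisorData.arith F).ModelGlobalFrobenioid⦄ (f g : X ⟶ Y), ModelFrobenioid.degFr f = 1 →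
          ModelFrobenioid.degFr g = 1 → ModelFrobenioid.baseMap f = ModelFrobenioid.baseMap g →
            ModelFrobenioid.unit (Ψ.functor.map f) *
                pull (GlobalDivisorData.arith F).B (A := X.base) (B := (Ψ.functor.obj X).base) (η.hom.app X)
                  (ModelFrobenioid.unit g) =
              ModelFrobenioid.unit (Ψ.functor.map g) *
                pull (GlobalDivisorData.arith F).B (A := X.base) (B := (Ψ.functor.obj X).base) (η.hom.app X)
                  (ModelFrobenioid.unit f)) :
    CatIsomorphism.RigidOverBase (GlobalDivisorData.arith F).modelBase :=
  Cor53.arith_rigidOverBase_of_divMonoidRigid_of_ratioRigid F (GlobalDivisorData.arith_divMonoid_eq_self_of_map_divB F) hB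

/-- **[IUTchI] Cor 5.3 (i) AS PRINTED («bijective») at `ℱ^⊛(†𝒟^⊚)`** from 𝔹-RATIO (FACT-SHAPE of F-2577, Ex 5.1 (v))
and the surjectivity half `hlift⊛` (BY NAME); injectivity alone is `(this …).1`. ([IUTchI] Cor 5.3 (i) p.144) [claim: Mochizuki2012, status: disputed] -/
theorem Cor53.arith_descendBijective_of_ratioRigid_of_lifts (F : Type) [Field F] [NumberField F]
    (hB : ∀ Ψ : (GlobalDivisorData.arith F).ModelGlobalFrobenioid ≌ (GlobalDivisorData.arith F).ModelGlobalFrobenioid,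
      Nonempty (Ψ.functor ⋙ (GlobalDivisorData.arith F).modelBase ≅ (GlobalDivisorData.arith F).modelBase) →
      ∃ η : Ψ.functor ⋙ (GlobalDivisorData.arith F).modelBase ≅ (GlobalDivisorData.arith F).modelBase,
        ∀ ⦃X Y : (GlobalDivisorData.arith F).ModelGlobalFrobenioid⦄ (f g : X ⟶ Y), ModelFrobenioid.degFr f = 1 →
          ModelFrobenioid.degFr g = 1 → ModelFrobenioid.baseMap f = ModelFrobenioid.baseMap g →
            ModelFrobenioid.unit (Ψ.functor.map f) *
                pull (GlobalDivisorData.arith F).B (A := X.base) (B := (Ψ.functor.obj X).base) (η.hom.app X)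
                  (ModelFrobenioid.unit g) =
              ModelFrobenioid.unit (Ψ.functor.map g) *
                pull (GlobalDivisorData.arith F).B (A := X.base) (B := (Ψ.functor.obj X).base) (η.hom.app X)
                  (ModelFrobenioid.unit f))
    (hlift : ∀ Θ : BaseCat (absGalGrp F) ≌ BaseCat (absGalGrp F),
      ∃ Ψ : (GlobalDivisorData.arith F).ModelGlobalFrobenioid ≌ (GlobalDivisorData.arith F).ModelGlobalFrobenioid,
        Nonempty (CatIsomorphism.LiesUnder (GlobalDivisorData.arith F).modelBase (GlobalDivisorData.arith F).modelBase Ψ Θ)) :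
    CatIsomorphism.DescendBijective (GlobalDivisorData.arith F).modelBase (GlobalDivisorData.arith F).modelBase
      (GlobalDivisorData.hasUnder_modelBase_arith F F) (GlobalDivisorData.underUnique_modelBase_arith F F) :=
  arith_descendBijective_of_divMonoidRigid_of_ratioRigid_of_lifts F (GlobalDivisorData.arith_divMonoid_eq_self_of_map_divB F) hB hlift

end Literature.IUT.HodgeTheaters

end
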